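import Summits.Ventures.QEDPrecision.SpectralMajorants.Gamma4Bound
import Summits.Ventures.QEDPrecision.Integrands.KallenSabryPhiIntegrable
import Mathlib.Analysis.SpecialFunctions.Integrals.Basic
import HarnessLib

/-!
# The Källén–Sabry weight `γ₄`, its even moments, and the real expansion `J₄(x) = Σ_j m_j w^{2j+2}`
(venture QEDPrecision, cell `pub-qed`, literature seat, gen 13; folder `SpectralMajorants/`, file 3a)

HONEST FRAMING (verbatim, venture QEDPrecision): independent recomputation; certified where stated,
statistical where stated; no new-physics claim.

## What this file is

§2.3/§2.4 (real part) of the I(b)/I(c) certificate's premise note `certs/SetIbIc/repr/gl_bounds.md` as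
KERNEL theorems about the typed inner integral `J₄(x) := ∫₀¹ ρ₄(t)/W_t(x) dt` of
`Literature/…/Jegerlehner2017/SpectralFunctionInsertions.lean` (p217042):

* `gamma4 t := ρ₄(t)(1 − t²)` (`= (2t/3)(A(D + ℓ₂L) + T₂L + T₃ + T₄)` with the (R-IBP) file's `ksD`,
  `ksT2`, `ksT3`, `ksT4`, `gamma4_eq_explicit`), continuous on `(0,1)`, `|γ₄| ≤ 19` there (file 2);
* the even moments `ksMoment j := ∫₀¹ γ₄(t) t^{2j} dt` with `|m_j| ≤ 19/(2j+1)` (`abs_ksMoment_le`);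
* the note's expansion "`x²/((2−x)²−x²t²) = w²/(1 − w²t²) = Σ_{j≥0} w^{2j+2} t^{2j}`, `w = x/(2−x)`, so
  `J₄ = Σ_j m_j w^{2j+2}` (termwise integration, dominated by `Γ Σ|w|^{2j+2}`)":
  `hasSum_integral_rho4_div_wt` — for `0 < x < 1`, `HasSum (j ↦ m_j w^{2j+2}) (∫₀¹ ρ₄/W_t(x) dt)`.

The complex extension, its analyticity and the majorant `𝒥(r) = Γ·u·atanh u` are in file 3b (`J4Series`).
NEW WORK of the cell (elementary analysis about the cell's typed objects), not a published result; nothing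
here is cited as a fact anywhere; no numerical value of any anomaly integral is asserted.  Not an R-row.
-/

noncomputable section

open Real Set MeasureTheory intervalIntegral

namespace Summit.Ventures.QEDPrecision.SpectralMajorants

open Literature.MathematicalPhysics.QuantumFieldTheory.Jegerlehner2017
open Literature.Analysis.SpecialFunctions (realDilog reDilog reDilog_eq_realDilog)
open Summit.Ventures.QEDPrecision.Integrands
/-! ### `γ₄` and its moments -/

/-- The bounded weight `γ₄(t) := ρ₄(t)·(1 − t²)` (gl_bounds.md §1), so that
`ρ₄/W_t(x) = γ₄(t)·x²/((2−x)² − x²t²)`. -/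
def gamma4 (t : ℝ) : ℝ := rho4 t * (1 - t ^ 2)

/-- `|γ₄| ≤ 19` on `[0,1)` (file 2). -/
theorem abs_gamma4_le {t : ℝ} (ht0 : 0 ≤ t) (ht1 : t < 1) : |gamma4 t| ≤ 19 :=
  abs_rho4_mul_one_sub_sq_le ht0 ht1

/-- `γ₄` vanishes at the junk point `t = 1` of Lean's `ρ₄` (so pointwise identities below hold on all of
`(0,1]`). -/
theorem gamma4_one : gamma4 1 = 0 := by simp [gamma4]

/-- `γ₄` in terms of the (R-IBP) file's regular pieces, on `[0,1)`:
`γ₄ = (2t/3)·(A·(D + ℓ₂L) + T₂L + T₃ + T₄)` with `D = ksD` (`reDilog` form). -/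
theorem gamma4_eq_explicit {t : ℝ} (ht0 : 0 ≤ t) (ht1 : t < 1) :
    gamma4 t = 2 * t / 3 *
      ((3 - t ^ 2) * (1 + t ^ 2) / 2 * (ksD t + log ((1 + t) / 2) * log ((1 + t) / (1 - t)))
        + (ksT2 t * log ((1 + t) / (1 - t)) + ksT3 t + ksT4 t)) := by
  have ht2 : t ^ 2 < 1 := by nlinarith
  have h1t : (1:ℝ) - t ^ 2 ≠ 0 := by nlinarith
  have e1 : realDilog ((1 - t) / (1 + t)) = reDilog ((1 - t) / (1 + t)) :=
    (reDilog_eq_realDilog (by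
      rw [abs_of_nonneg (div_nonneg (by linarith) (by linarith)), div_le_one (by linarith)]
      linarith)).symm
  have e2 : realDilog ((1 + t) / 2) = reDilog ((1 + t) / 2) :=
    (reDilog_eq_realDilog (by
      rw [abs_of_nonneg (div_nonneg (by linarith) (by norm_num)), div_le_one (by norm_num)]
      linarith)).symm
  have e3 : realDilog ((1 - t) / 2) = reDilog ((1 - t) / 2) :=
    (reDilog_eq_realDilog (by
      rw [abs_of_nonneg (div_nonneg (by linarith) (by norm_num)), div_le_one (by norm_num)]
      linarith)).symm
  have e4 : realDilog t = reDilog t :=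
    (reDilog_eq_realDilog (by rw [abs_of_nonneg ht0]; exact ht1.le)).symm
  have e5 : realDilog (t ^ 2) = reDilog (t ^ 2) :=
    (reDilog_eq_realDilog (by rw [abs_of_nonneg (by positivity)]; exact ht2.le)).symm
  unfold gamma4 rho4 ksD ksT2 ksT3 ksT4
  rw [Literature.Analysis.SpecialFunctions.realDilog_one, e1, e2, e3, e4, e5]
  field_simp
  ring

/-- `γ₄` is continuous on `(0,1)`. -/
theorem continuousOn_gamma4 : ContinuousOn gamma4 (Ioo 0 1) := by
  have hD : ContinuousOn (fun t : ℝ => ksD t) (Ioo 0 1) := continuousOn_ksD.mono Ioo_subset_Icc_self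
  have hl2 : ContinuousOn (fun t : ℝ => log ((1 + t) / 2)) (Ioo 0 1) := by
    refine ContinuousOn.log (by fun_prop) ?_
    intro t ht
    have : (0:ℝ) < 1 + t := by linarith [ht.1]
    exact (div_pos this two_pos).ne'
  have hL : ContinuousOn (fun t : ℝ => log ((1 + t) / (1 - t))) (Ioo 0 1) := by
    refine ContinuousOn.log ?_ ?_
    · exact ContinuousOn.div (by fun_prop) (by fun_prop) fun t ht => by
        have : (0:ℝ) < 1 - t := by linarith [ht.2]
        exact this.ne'
    · intro t ht
      have h1 : (0:ℝ) < 1 + t := by linarith [ht.1]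
      have h2 : (0:ℝ) < 1 - t := by linarith [ht.2]
      exact (div_pos h1 h2).ne'
  have hlog : ContinuousOn (fun t : ℝ => log t) (Ioo 0 1) :=
    continuousOn_log.mono fun t ht => ne_of_gt ht.1
  have hT3 : ContinuousOn (fun t : ℝ => ksT3 t) (Ioo 0 1) := by
    unfold ksT3
    exact ContinuousOn.mul (by fun_prop) ((continuousOn_const.mul hl2).sub (continuousOn_const.mul hlog))
  have hT2 : ContinuousOn (fun t : ℝ => ksT2 t) (Ioo 0 1) := by unfold ksT2; fun_prop
  have hT4 : ContinuousOn (fun t : ℝ => ksT4 t) (Ioo 0 1) := by unfold ksT4; fun_prop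
  have hA : ContinuousOn (fun t : ℝ => (3 - t ^ 2) * (1 + t ^ 2) / 2) (Ioo 0 1) := by fun_prop
  have h23 : ContinuousOn (fun t : ℝ => 2 * t / 3) (Ioo 0 1) := by fun_prop
  have hfull : ContinuousOn (fun t : ℝ => 2 * t / 3 *
      ((3 - t ^ 2) * (1 + t ^ 2) / 2 * (ksD t + log ((1 + t) / 2) * log ((1 + t) / (1 - t)))
        + (ksT2 t * log ((1 + t) / (1 - t)) + ksT3 t + ksT4 t))) (Ioo 0 1) :=
    h23.mul ((hA.mul (hD.add (hl2.mul hL))).add (((hT2.mul hL).add hT3).add hT4))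
  refine hfull.congr ?_
  intro t ht
  exact gamma4_eq_explicit ht.1.le ht.2

/-- `γ₄·t^{2j}` is interval-integrable on `[0,1]`. -/
theorem intervalIntegrable_gamma4_mul_pow (j : ℕ) :
    IntervalIntegrable (fun t : ℝ => gamma4 t * t ^ (2 * j)) volume 0 1 := by
  refine intervalIntegrable_of_continuousOn_Ioo_of_bound (C := 19) zero_le_one
    (continuousOn_gamma4.mul (by fun_prop)) ?_
  intro t ht
  rw [abs_mul, abs_of_nonneg (pow_nonneg ht.1.le _)]
  have h1 : t ^ (2 * j) ≤ 1 := pow_le_one₀ ht.1.le ht.2.le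
  have h2 := abs_gamma4_le ht.1.le ht.2
  nlinarith [abs_nonneg (gamma4 t)]

/-- The even moments of `γ₄`: `m_j := ∫₀¹ γ₄(t) t^{2j} dt` (gl_bounds.md §2.3). -/
def ksMoment (j : ℕ) : ℝ := ∫ t in (0:ℝ)..1, gamma4 t * t ^ (2 * j)

/-- `|m_j| ≤ Γ/(2j+1)` with `Γ = 19`. -/
theorem abs_ksMoment_le (j : ℕ) : |ksMoment j| ≤ 19 / (2 * (j : ℝ) + 1) := by
  unfold ksMoment
  have hb : ∀ᵐ t : ℝ, t ∈ Ioc (0:ℝ) 1 → ‖gamma4 t * t ^ (2 * j)‖ ≤ 19 * t ^ (2 * j) := by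
    refine Filter.Eventually.of_forall fun t ht => ?_
    rw [Real.norm_eq_abs, abs_mul, abs_of_nonneg (pow_nonneg ht.1.le _)]
    rcases eq_or_lt_of_le ht.2 with h | h
    · subst h; simp [gamma4_one]
    · exact mul_le_mul_of_nonneg_right (abs_gamma4_le ht.1.le h) (pow_nonneg ht.1.le _)
  have h := intervalIntegral.norm_integral_le_of_norm_le zero_le_one hb
    ((intervalIntegral.intervalIntegrable_pow (2 * j)).const_mul 19)
  rw [Real.norm_eq_abs] at h
  refine h.trans (le_of_eq ?_)
  rw [intervalIntegral.integral_const_mul, integral_pow]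
  push_cast
  ring

/-- The uniform bound `|m_j| ≤ 19`. -/
theorem abs_ksMoment_le' (j : ℕ) : |ksMoment j| ≤ 19 := by
  refine (abs_ksMoment_le j).trans ?_
  rw [div_le_iff₀ (by positivity)]
  have : (0:ℝ) ≤ j := Nat.cast_nonneg j
  nlinarith

/-! ### The real expansion `J₄(x) = Σ_j m_j w^{2j+2}`, `w = x/(2−x)` -/

/-- Pointwise on `[0,1) × (0,1)`: `ρ₄/W = γ₄·x²/((2−x)² − x²t²)`. -/
theorem rho4_div_wt_eq_gamma4 {x t : ℝ} (hx0 : 0 < x) (hx1 : x < 1) (ht0 : 0 ≤ t) (ht1 : t < 1) :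
    rho4 t / wt t x 1 = gamma4 t * (x ^ 2 / ((2 - x) ^ 2 - x ^ 2 * t ^ 2)) := by
  have ht2 : t ^ 2 < 1 := by nlinarith
  have h1t : (1:ℝ) - t ^ 2 ≠ 0 := by nlinarith
  have hx : x ≠ 0 := hx0.ne'
  have hx2 : 0 < x ^ 2 := by positivity
  have hxt : x ^ 2 * t ^ 2 < x ^ 2 := by nlinarith
  have hden : (2 - x) ^ 2 - x ^ 2 * t ^ 2 ≠ 0 := by nlinarith
  have hW : wt t x 1 = ((2 - x) ^ 2 - x ^ 2 * t ^ 2) / ((1 - t ^ 2) * x ^ 2) := by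
    unfold wt; field_simp; ring
  rw [hW, gamma4]
  field_simp

/-- The geometric expansion of the rational kernel: for `0 < x < 1`, `0 ≤ t ≤ 1`, with `w = x/(2−x)`,
`HasSum (j ↦ w^{2j+2} t^{2j}) (x²/((2−x)² − x²t²))`. -/
theorem hasSum_kernel {x t : ℝ} (hx0 : 0 < x) (hx1 : x < 1) (ht0 : 0 ≤ t) (ht1 : t ≤ 1) :
    HasSum (fun j : ℕ => (x / (2 - x)) ^ (2 * j + 2) * t ^ (2 * j))
      (x ^ 2 / ((2 - x) ^ 2 - x ^ 2 * t ^ 2)) := by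
  have h2x : 0 < 2 - x := by linarith
  set w := x / (2 - x) with hw
  have hw0 : 0 ≤ w := div_nonneg hx0.le h2x.le
  have hw1 : w < 1 := by rw [hw, div_lt_one h2x]; linarith
  have hq0 : 0 ≤ w ^ 2 * t ^ 2 := by positivity
  have hq1 : w ^ 2 * t ^ 2 < 1 := by
    have : w ^ 2 < 1 := by nlinarith
    have ht2 : t ^ 2 ≤ 1 := pow_le_one₀ ht0 ht1
    nlinarith
  have hg := (hasSum_geometric_of_lt_one hq0 hq1).mul_left (w ^ 2)
  have hval : w ^ 2 * (1 - w ^ 2 * t ^ 2)⁻¹ = x ^ 2 / ((2 - x) ^ 2 - x ^ 2 * t ^ 2) := by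
    have hden : (2 - x) ^ 2 - x ^ 2 * t ^ 2 ≠ 0 := by
      have : x ^ 2 * t ^ 2 ≤ x ^ 2 := by nlinarith [pow_le_one₀ ht0 ht1 (n := 2), sq_nonneg x]
      nlinarith
    have h1q : 1 - w ^ 2 * t ^ 2 ≠ 0 := by linarith
    rw [hw] at h1q ⊢
    field_simp
  rw [hval] at hg
  refine hg.congr_fun fun j => ?_
  ring

/-- **`J₄(x) = Σ_j m_j w^{2j+2}`** for `0 < x < 1`, `w = x/(2−x)` (termwise integration, dominated by
`19·Σ w^{2j+2}`). -/
theorem hasSum_integral_rho4_div_wt {x : ℝ} (hx0 : 0 < x) (hx1 : x < 1) :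
    HasSum (fun j : ℕ => ksMoment j * (x / (2 - x)) ^ (2 * j + 2))
      (∫ t in (0:ℝ)..1, rho4 t / wt t x 1) := by
  have h2x : 0 < 2 - x := by linarith
  set w := x / (2 - x) with hw
  have hw0 : 0 ≤ w := div_nonneg hx0.le h2x.le
  have hw1 : w < 1 := by rw [hw, div_lt_one h2x]; linarith
  -- the terms F j t = γ₄(t) t^{2j} w^{2j+2}
  set F : ℕ → ℝ → ℝ := fun j t => gamma4 t * t ^ (2 * j) * w ^ (2 * j + 2) with hF
  have hint : ∀ j, Integrable (F j) (volume.restrict (Ioc (0:ℝ) 1)) := by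
    intro j
    have h := ((intervalIntegrable_gamma4_mul_pow j).mul_const (w ^ (2 * j + 2)))
    rw [intervalIntegrable_iff_integrableOn_Ioc_of_le zero_le_one] at h
    exact h
  have hnorm : ∀ j, ∫ t in Ioc (0:ℝ) 1, ‖F j t‖ ≤ 19 * w ^ (2 * j + 2) := by
    intro j
    have hle : ∀ t ∈ Ioc (0:ℝ) 1, ‖F j t‖ ≤ 19 * w ^ (2 * j + 2) := by
      intro t ht
      simp only [hF, Real.norm_eq_abs, abs_mul, abs_pow, abs_of_nonneg hw0]
      rw [abs_of_nonneg ht.1.le]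
      have hγ : |gamma4 t| ≤ 19 := by
        rcases eq_or_lt_of_le ht.2 with h | h
        · subst h; simp [gamma4_one]
        · exact abs_gamma4_le ht.1.le h
      have ht2j : t ^ (2 * j) ≤ 1 := pow_le_one₀ ht.1.le ht.2
      have hwp : 0 ≤ w ^ (2 * j + 2) := pow_nonneg hw0 _
      have hA : |gamma4 t| * t ^ (2 * j) ≤ 19 * 1 :=
        mul_le_mul hγ ht2j (pow_nonneg ht.1.le _) (by norm_num)
      calc |gamma4 t| * t ^ (2 * j) * w ^ (2 * j + 2) ≤ 19 * 1 * w ^ (2 * j + 2) :=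
            mul_le_mul_of_nonneg_right hA hwp
        _ = 19 * w ^ (2 * j + 2) := by ring
    calc ∫ t in Ioc (0:ℝ) 1, ‖F j t‖ ≤ ∫ t in Ioc (0:ℝ) 1, (19 * w ^ (2 * j + 2) : ℝ) := by
          refine setIntegral_mono_on (hint j).norm (integrableOn_const (hs := measure_Ioc_lt_top.ne))
            measurableSet_Ioc hle
      _ = 19 * w ^ (2 * j + 2) := by simp
  have hsum : Summable fun j => ∫ t in Ioc (0:ℝ) 1, ‖F j t‖ := by
    refine Summable.of_nonneg_of_le (fun _ => integral_nonneg fun _ => norm_nonneg _) hnorm ?_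
    have hg : Summable fun j : ℕ => (w ^ 2) ^ j := summable_geometric_of_lt_one (by positivity)
      (by nlinarith)
    refine ((hg.mul_left (19 * w ^ 2))).congr fun j => ?_
    rw [← pow_mul, show 2 * j + 2 = 2 * j + 2 from rfl]; ring
  have hmain := MeasureTheory.hasSum_integral_of_summable_integral_norm hint hsum
  -- identify the pointwise sum with ρ₄/W on (0,1]
  have hpt : ∀ t ∈ Ioc (0:ℝ) 1, ∑' j, F j t = rho4 t / wt t x 1 := by
    intro t ht
    rcases eq_or_lt_of_le ht.2 with h | h
    · subst h
      simp [hF, gamma4_one, rho4, wt]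
    · have hk := (hasSum_kernel hx0 hx1 ht.1.le ht.2).mul_left (gamma4 t)
      rw [← rho4_div_wt_eq_gamma4 hx0 hx1 ht.1.le h] at hk
      have hk' : HasSum (fun j => F j t) (rho4 t / wt t x 1) := by
        refine hk.congr_fun fun j => ?_
        simp only [hF]; ring
      exact hk'.tsum_eq
  rw [setIntegral_congr_fun measurableSet_Ioc hpt, ← intervalIntegral.integral_of_le zero_le_one]
    at hmain
  refine hmain.congr_fun fun j => ?_
  show ksMoment j * w ^ (2 * j + 2) = ∫ t in Ioc (0:ℝ) 1, F j t
  rw [← intervalIntegral.integral_of_le zero_le_one]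
  simp only [hF, ksMoment]
  rw [intervalIntegral.integral_mul_const]

end Summit.Ventures.QEDPrecision.SpectralMajorants

end
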